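import Summits.QuantumFields.BalabanUV.T4Continuum.Support.NE7OneStepGenericSliceSector
import Summits.QuantumFields.BalabanUV.T4Continuum.Support.NE7SoftDataPath
import HarnessLib

/-!
# NE7SoftDataPathGenericSlice — F29 §3–§4 (`NE7SoftDataPath`, THE END OF RECORD of gen 68: ONE-STEP for all sufficiently small data ⇐ (APE) ∧ (REP^gauge) on the CLASS of
# small data — no path, no gauge in the letters) OVER AN ABSTRACT SLICE FAMILY `𝒯 k W`, and its SU(2) `d = 4` `L = 2` END for the corner-free slice `𝒯_E = energyBlockLandauW`
# — file 7 (the last mechanical one) of the END re-thread of the Bałaban-slice road (memo ROAD-G99 §3.5 ∕ §3.8 (C))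

Cell `pub-balaban`, sub-cell t4, lineage `b2b-balaban-t4-ne7-p1`, generation 99 (CRUX PROVER NE7 #1 = OWNER of BINDER row NE7); over gen 99's `NE7OneStepGenericSliceSector`
(F28 over `(𝒯, hT, hP)`) and F29's slice-free §1–§2 (`exists_flat_near` — almost flat ⇒ near flat by compactness; `exists_chord`; the geodesic segment from a flat datum) BY NAME.
WHY ∕ WHAT ([folklore]; 0 def, 0 sorry).  F29 §3–§4 hardcode `X_T ∈ T_♮(U♯)`; re-issued GENERICALLY in `𝒯 : ℕ → cfg → Set dir` with (hT) «tangent-critical ⟹ critical on `𝒯 j W`» and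
(hP) «class SlicePoincare for `𝒯 j W`», proof of record verbatim: **`oneStep_of_dataClass_ape_rep_generic_gauge`** — if (APE) and (REP^gauge over `𝒯`) hold at EVERY datum of the class
`𝒟_β = {D unitary, N-periodic, SmallField D (4(e^β − 1))}` (F28's shapes, `β > 0` free), then `∃ γ > 0` such that ONE-STEP holds at every unitary `N`-periodic `V` with `SmallField V γ`
(`γ` inexplicit: compactness); **`oneStep_SU2_of_dataClass_ape_repE_gauge`** — `d = 4`, `L = 2`, `card n = 2`, `0 < ε ≤ 10⁻⁵³`, slice `𝒯_E`: (hT) by `hT_energyBlockLandau`, (hP) by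
`classSlicePoincare_energyBlockLandau_SU2` (constant `8·CPLine 4 2 2 10⁻¹⁷ 10⁻⁵³ + 1`), level family and class smallness DISCHARGED — THE END OF RECORD OF THE BAŁABAN-SLICE ROAD modulo
its two letters: (APE) ([Balaban1985Variational] Sect. F TYPE) and (REP^gauge over `𝒯_E`) (= the supplier of memo §3.8 (B): ONE curved sup letter for `𝒯_E` + the nonlinear slice theorem).
HONEST FRAMING (page 1): soft topology + kinematics over HYPOTHESES; the two letters asserted for nothing; `γ` NOT explicit; NOT ONE-STEP, NOT NE7; spine 0∕9; finite T⁴ rung (B)+1 — NOT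
infinite volume, NOT mass gap, NOT BetaPertH, NOT Clay.  Continuum YM on T⁴ ⇐ BetaPertH ∧ nine spine estimates (0/9 proved); BetaPertH ⇐ (D1) ∧ (D4) ∧ CAP+tail; G-an2-4 gates
asym, D1 and NE2/3/4.
-/

set_option autoImplicit false

open scoped BigOperators Matrix Matrix.Norms.L2Operator Topology
open NormedSpace Finset Set Filter

namespace Summit.QuantumFields.BalabanUV.T4Continuum.NE7SoftDataPathGenericSlice


open Literature.MathematicalPhysics.QuantumFieldTheory.Balaban1983to89
open B7Prop1Explicit B7Prop2Explicit MatrixLog UnitaryModel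
open T4AveragingDeficitWall (IsUnitaryCfg IsSkewDir SmallField vary curl)
open T4AveragingDeficitWallBoundary (IsPeriodicCfg periodBox)
open AveragingDeficitPeriodicCounting (IsPeriodicDir)
open AveragingDeficitTorusChart (redN eq_wrap_add periodic_smul_vec)
open AveragingDeficitFermat (boxVec_redN_mem)
open AveragingDeficitMultiLevelPrep (LevelSmall TangentIter)
open MinimalActionLevels (levelAction perWin)
open MinimalActionSandwich (IsMinimiser admissible)
open MinimalActionRate (sfClass)
open MinimalActionWitness (flatCfg)
open MinimalActionCompact (isCompact_sfClass isClosed_smallField)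
open NE3HessForm (dAction)
open NE3SlicePoincareShape (SlicePoincare slicePoincare_mono)
open NE3SlicePoincareBudgetLine (CPLine)
open NE3ClassRadiusFamily (CPLine_nonneg_d4_L2)
open NE7ConvOneStepSU2 (levelSmall_all_d4_L2)
open NE7OneStepOfPathOpen (classSmall_d4_L2)
open NE3EnergyWeightedShapes (energyNormW)
open NE3EnergyShapes (IsUnitarySite)
open NE3EnergyRateFlatClass (exists_unitary_gauge_eq_gaugeAct_flatCfg)
open NE3ClassSixFlatWitness (hol_gaugeAct_flatCfg_plaqWord)
open NE7EtaBackgroundFlatStratum (blowup_mem_admissible_flatStratum)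
open NE7DataPathExp (continuous_expPath expPath_zero expPath_mem_sfClass₀)
open NE7DataExpChartGlobalGauge (exists_logFun)
open NE7AdmissibleFibreLHC (continuous_relVal)

open NE7SoftDataPath (exists_flat_near exists_chord)
open NE7OneStepGenericSliceSector (oneStep_of_path_ape_rep_generic_gauge)
open NE7MeanZeroGaugeSliceW (energyBlockLandauW)
open NE7EnergyBlockLandauClassPoincare (classSlicePoincare_energyBlockLandau_SU2)
open NE7ConvOneStepGenericSlice (hT_energyBlockLandau)
open AveragingDeficitMultiLevelPrep (tower)
open T4AveragingDeficitWall (Plaq)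

noncomputable section

variable {d : ℕ} {n : Type*} [Fintype n] [DecidableEq n]

/-! ## §3 The END over a data class, abstract slice family -/

/-- **ONE-STEP FOR ALL SUFFICIENTLY SMALL DATA ⇐ (APE) ∧ (REP^gauge over `𝒯`) ON THE DATA CLASS `𝒟_β`** (generic `d`, `L ≥ 2`, every `N ≥ 1`; `0 ≤ δ₁ < δ < ε`, `β > 0`;
class smallness, the `LevelSmall` family and (hT), (hP) with constant `CP` as in `NE7OneStepGenericSlicePath`).  The two letters are asked at every unitary `N`-periodic datum `D` with
`SmallField D (4(e^β − 1))`, in F28's shapes; the conclusion is the ONE-STEP binder of `NE7InteriorInduction.interior_exists_all_levels` at every unitary `N`-periodic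
`V` with `SmallField V γ`, for SOME `γ > 0` depending only on `(β, N, n, d)` (compactness, §1).  Path used: the geodesic segment from a flat datum `ε′`-close to `V`
(§1, `ε′ = β∕2`), whose start carries flat admissible lifts at every level ([tree] `blowup_mem_admissible_flatStratum`) and whose data lie in `𝒟_β` (F21). [folklore] -/
theorem oneStep_of_dataClass_ape_rep_generic_gauge [Nonempty n] {L N : ℕ} [NeZero L] [NeZero N] (hL : 2 ≤ L) (hN : 1 ≤ N) {ε δ δ₁ CP β : ℝ} (hε0 : 0 ≤ ε)
    (hε1 : 16 * C0 d * ε ≤ 3) (hε2 : 1024 * (d + 1) * (d + 4) * (L : ℝ) ^ 2 * ε ≤ 1) (hδ₁ : 0 ≤ δ₁) (hδ₁δ : δ₁ < δ) (hδε : δ < ε) (hCP : 0 < CP)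
    (hβ : 0 < β) (hls : ∀ k : ℕ, LevelSmall d L k (ε / ((L : ℝ) ^ (k + 1)) ^ 2))
    (𝒯 : ℕ → (Site d → Fin d → (Matrix n n ℂ)ˣ) → Set (Site d → Fin d → Matrix n n ℂ))
    (hT : ∀ (j : ℕ) (W : Site d → Fin d → (Matrix n n ℂ)ˣ), W ∈ sfClass d L N ε (j + 1) → ∀ F : Finset (Plaq d),
      (∀ φ : Site d → Fin d → Matrix n n ℂ, IsSkewDir φ → IsPeriodicDir φ ((tower L N (j + 1) : ℕ) : ℤ) → TangentIter L j W φ → dAction W φ F = 0) →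
      ∀ Y ∈ 𝒯 j W, dAction W Y F = 0)
    (hP : ∀ (j : ℕ) (W : Site d → Fin d → (Matrix n n ℂ)ˣ), W ∈ sfClass d L N ε (j + 1) →
      SlicePoincare L (j + 1) W (𝒯 j W) CP (periodBox (d := d) (N * L ^ (j + 1))))
    (hape : ∀ D : Site d → Fin d → (Matrix n n ℂ)ˣ, IsUnitaryCfg D → IsPeriodicCfg D (N : ℤ) → SmallField D (4 * (Real.exp β - 1)) →
      ∀ (k : ℕ), ∀ U ∈ admissible (sfClass d L N ε) L (k + 1) D, SmallField U (δ / ((L : ℝ) ^ (k + 1)) ^ 2) →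
      (∀ φ : Site d → Fin d → Matrix n n ℂ, IsSkewDir φ → IsPeriodicDir φ ((N * L ^ (k + 1) : ℕ) : ℤ) → TangentIter L k U φ →
        dAction U φ (perWin d (N * L ^ (k + 1))) = 0) → SmallField U (δ₁ / ((L : ℝ) ^ (k + 1)) ^ 2))
    (hrep : ∀ D : Site d → Fin d → (Matrix n n ℂ)ˣ, IsUnitaryCfg D → IsPeriodicCfg D (N : ℤ) → SmallField D (4 * (Real.exp β - 1)) →
      ∀ (k : ℕ), ∀ Us ∈ admissible (sfClass d L N ε) L (k + 1) D, SmallField Us (δ₁ / ((L : ℝ) ^ (k + 1)) ^ 2) →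
      (∀ φ : Site d → Fin d → Matrix n n ℂ, IsSkewDir φ → IsPeriodicDir φ ((N * L ^ (k + 1) : ℕ) : ℤ) → TangentIter L k Us φ →
        dAction Us φ (perWin d (N * L ^ (k + 1))) = 0) →
      ∀ U' ∈ admissible (sfClass d L N ε) L (k + 1) D, ∃ (u : Site d → (Matrix n n ℂ)ˣ) (X XT XN : Site d → Fin d → Matrix n n ℂ)
        (α ν κ₁ : ℝ), IsUnitarySite u ∧ IsSkewDir X ∧ IsPeriodicDir X ((N * L ^ (k + 1) : ℕ) : ℤ) ∧ 0 ≤ α ∧ (∀ x μ, ‖X x μ‖ ≤ α) ∧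
        gaugeAct u U' = vary Us X 1 ∧
        X = XT + XN ∧ XT ∈ 𝒯 k Us ∧ IsSkewDir XN ∧ 0 ≤ ν ∧
        energyNormW L (k + 1) Us XN (periodBox (d := d) (N * L ^ (k + 1)))
          ≤ ν * energyNormW L (k + 1) Us X (periodBox (d := d) (N * L ^ (k + 1))) ∧
        ε / ((L : ℝ) ^ (k + 1)) ^ 2 * (∑ p ∈ perWin d (N * L ^ (k + 1)), ‖curl Us XN p‖)
          ≤ κ₁ * energyNormW L (k + 1) Us X (periodBox (d := d) (N * L ^ (k + 1))) ^ 2 ∧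
        2 * κ₁ < ((((1 / 2 - ν ^ 2) / (2 * (1 + CP)) - ν ^ 2) / 2
            - 576 * d * (Real.exp α - 1) ^ 2 * ((L : ℝ) ^ (k + 1)) ^ 2) / (Fintype.card n : ℝ)
            - 28 * d * (ε / ((L : ℝ) ^ (k + 1)) ^ 2 + 7 * α ^ 2) * ((L : ℝ) ^ (k + 1)) ^ 2)) :
    ∃ γ : ℝ, 0 < γ ∧ ∀ V : Site d → Fin d → (Matrix n n ℂ)ˣ, IsUnitaryCfg V → IsPeriodicCfg V (N : ℤ) → SmallField V γ →
      ∀ (k : ℕ) (U₀ : Site d → Fin d → (Matrix n n ℂ)ˣ), U₀ ∈ admissible (sfClass d L N ε) L (k + 1) V →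
        SmallField U₀ (δ / ((L : ℝ) ^ k) ^ 2) →
        ∃ U, IsMinimiser d (sfClass d L N ε) L N (k + 1) V U ∧ SmallField U (δ / ((L : ℝ) ^ (k + 1)) ^ 2) := by
  have hL1 : 1 ≤ L := by omega
  obtain ⟨γ, hγ, hnear⟩ := exists_flat_near (d := d) (n := n) (N := N) (ε' := β / 2) (by positivity)
  refine ⟨γ, hγ, fun V hVu hVP hVγ => ?_⟩
  obtain ⟨F, hFu, hFP, hFflat, hFV⟩ := hnear V hVu hVP hVγ
  -- the flat datum is a pure gauge and carries flat admissible lifts at every level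
  obtain ⟨w, hwu, hFw⟩ := exists_unitary_gauge_eq_gaugeAct_flatCfg hFu hFflat
  have hF0 : SmallField F 0 := fun x κ κ' hκ => by rw [hFflat x κ κ' hκ]; simp
  -- the chord and the segment path
  obtain ⟨X, hXs, hXP, hFX, hXb⟩ := exists_chord N hFu hFP hVu hVP
  have hXβ : ∀ (x : Site d) (κ : Fin d), ‖X x κ‖ ≤ β := by
    intro x κ
    refine (hXb x κ).trans ?_
    have h1 := hFV x κ
    have hπ : Real.pi / 2 ≤ 2 := by linarith [Real.pi_lt_four]
    calc Real.pi / 2 * ‖(((F x κ)⁻¹ : (Matrix n n ℂ)ˣ) : Matrix n n ℂ) * (V x κ : Matrix n n ℂ) - 1‖ ≤ 2 * (β / 2) :=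
          mul_le_mul hπ h1 (norm_nonneg _) (by norm_num)
      _ = β := by ring
  set γp : ℝ → (Site d → Fin d → (Matrix n n ℂ)ˣ) := fun τ => vary F (τ • X) 1 with hγp
  have hγc : ContinuousOn γp (Icc (0 : ℝ) 1) := (continuous_expPath F X).continuousOn
  have hdata : ∀ τ ∈ Icc (0 : ℝ) 1, IsUnitaryCfg (γp τ) ∧ IsPeriodicCfg (γp τ) (N : ℤ) ∧ SmallField (γp τ) (4 * (Real.exp β - 1)) := by
    intro τ hτ
    obtain ⟨h1, h2, h3⟩ := expPath_mem_sfClass₀ L N hFu hFP hF0 hXs hXP hXβ hτ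
    refine ⟨h1, by simpa using h2, ?_⟩
    simpa using h3
  have h0 : ∀ k : ℕ, ∃ U₀ : Site d → Fin d → (Matrix n n ℂ)ˣ, U₀ ∈ admissible (sfClass d L N ε) L (k + 1) (γp 0) ∧ SmallField U₀ 0 := by
    intro k
    have hwP : IsPeriodicCfg (gaugeAct w (flatCfg : Site d → Fin d → (Matrix n n ℂ)ˣ)) (N : ℤ) := by rw [← hFw]; exact hFP
    refine ⟨gaugeAct (fun z : Site d => w (fun i => z i / ((L : ℤ) ^ (k + 1)))) flatCfg, ?_, fun x κ κ' _ => ?_⟩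
    · have h := blowup_mem_admissible_flatStratum (d := d) (n := n) (N := N) hL1 hε0 hwu hwP (k + 1)
      rw [← hFw] at h
      simpa only [hγp, expPath_zero] using h
    · rw [hol_gaugeAct_flatCfg_plaqWord]; simp
  have hγ1 : γp 1 = V := by simp only [hγp, one_smul]; exact hFX
  exact oneStep_of_path_ape_rep_generic_gauge hL hN hε0 hε1 hε2 hδ₁ hδ₁δ hδε hCP hls 𝒯 hT hP γp hγc (fun τ hτ => (hdata τ hτ).1)
    (fun τ hτ => (hdata τ hτ).2.1) h0 hγ1 (fun k τ hτ => hape (γp τ) (hdata τ hτ).1 (hdata τ hτ).2.1 (hdata τ hτ).2.2 k)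
    (fun k τ hτ => hrep (γp τ) (hdata τ hτ).1 (hdata τ hτ).2.1 (hdata τ hτ).2.2 k)

/-! ## §4 The programme's case `d = 4`, `L = 2`, SU(2) ∕ U(2) over `𝒯_E`: the END of record of the Bałaban-slice road -/

/-- **ONE-STEP FOR ALL SUFFICIENTLY SMALL DATA AT `d = 4`, `L = 2`, SU(2)∕U(2) (`card n = 2`), `0 < ε ≤ 10⁻⁵³`, `0 ≤ δ₁ < δ < ε`, `β > 0`, EVERY `N ≥ 1`, FROM (APE) ∧
(REP^gauge over `𝒯_E = energyBlockLandauW`) ON THE DATA CLASS `𝒟_β` ONLY** — (hT) (`hT_energyBlockLandau`), (hP) (`classSlicePoincare_energyBlockLandau_SU2`), the level family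
and the class smallness discharged (`levelSmall_all_d4_L2`, `classSmall_d4_L2`); constant of record `CP = 8·CPLine 4 2 2 10⁻¹⁷ 10⁻⁵³ + 1`; `γ` inexplicit (compactness) — THE END OF
RECORD OF THE BAŁABAN-SLICE ROAD modulo (APE) and the `𝒯_E` supplier. [folklore] -/
theorem oneStep_SU2_of_dataClass_ape_repE_gauge [Nonempty n] (hn : Fintype.card n = 2) {N : ℕ} [NeZero N] (hN : 1 ≤ N) {ε δ δ₁ β : ℝ} (hε : 0 < ε)
    (hε' : ε ≤ 1 / 10 ^ 53) (hδ₁ : 0 ≤ δ₁) (hδ₁δ : δ₁ < δ) (hδε : δ < ε) (hβ : 0 < β)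
    (hape : ∀ D : Site 4 → Fin 4 → (Matrix n n ℂ)ˣ, IsUnitaryCfg D → IsPeriodicCfg D (N : ℤ) → SmallField D (4 * (Real.exp β - 1)) →
      ∀ (k : ℕ), ∀ U ∈ admissible (sfClass 4 2 N ε) 2 (k + 1) D, SmallField U (δ / ((((2 : ℕ) : ℝ)) ^ (k + 1)) ^ 2) →
      (∀ φ : Site 4 → Fin 4 → Matrix n n ℂ, IsSkewDir φ → IsPeriodicDir φ ((N * 2 ^ (k + 1) : ℕ) : ℤ) → TangentIter 2 k U φ →
        dAction U φ (perWin 4 (N * 2 ^ (k + 1))) = 0) → SmallField U (δ₁ / ((((2 : ℕ) : ℝ)) ^ (k + 1)) ^ 2))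
    (hrep : ∀ D : Site 4 → Fin 4 → (Matrix n n ℂ)ˣ, IsUnitaryCfg D → IsPeriodicCfg D (N : ℤ) → SmallField D (4 * (Real.exp β - 1)) →
      ∀ (k : ℕ), ∀ Us ∈ admissible (sfClass 4 2 N ε) 2 (k + 1) D, SmallField Us (δ₁ / ((((2 : ℕ) : ℝ)) ^ (k + 1)) ^ 2) →
      (∀ φ : Site 4 → Fin 4 → Matrix n n ℂ, IsSkewDir φ → IsPeriodicDir φ ((N * 2 ^ (k + 1) : ℕ) : ℤ) → TangentIter 2 k Us φ →
        dAction Us φ (perWin 4 (N * 2 ^ (k + 1))) = 0) →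
      ∀ U' ∈ admissible (sfClass 4 2 N ε) 2 (k + 1) D, ∃ (u : Site 4 → (Matrix n n ℂ)ˣ) (X XT XN : Site 4 → Fin 4 → Matrix n n ℂ)
        (α ν κ₁ : ℝ), IsUnitarySite u ∧ IsSkewDir X ∧ IsPeriodicDir X ((N * 2 ^ (k + 1) : ℕ) : ℤ) ∧ 0 ≤ α ∧ (∀ x μ, ‖X x μ‖ ≤ α) ∧
        gaugeAct u U' = vary Us X 1 ∧
        X = XT + XN ∧ XT ∈ energyBlockLandauW (d := 4) (n := n) 2 N (k + 1) Us ∧ IsSkewDir XN ∧ 0 ≤ ν ∧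
        energyNormW 2 (k + 1) Us XN (periodBox (d := 4) (N * 2 ^ (k + 1)))
          ≤ ν * energyNormW 2 (k + 1) Us X (periodBox (d := 4) (N * 2 ^ (k + 1))) ∧
        ε / ((((2 : ℕ) : ℝ)) ^ (k + 1)) ^ 2 * (∑ p ∈ perWin 4 (N * 2 ^ (k + 1)), ‖curl Us XN p‖)
          ≤ κ₁ * energyNormW 2 (k + 1) Us X (periodBox (d := 4) (N * 2 ^ (k + 1))) ^ 2 ∧
        2 * κ₁ < ((((1 / 2 - ν ^ 2) / (2 * (1 + (8 * CPLine 4 2 2 (1 / 10 ^ 17) (1 / 10 ^ 53) + 1))) - ν ^ 2) / 2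
            - 576 * (4 : ℕ) * (Real.exp α - 1) ^ 2 * ((((2 : ℕ) : ℝ)) ^ (k + 1)) ^ 2) / (Fintype.card n : ℝ)
            - 28 * (4 : ℕ) * (ε / ((((2 : ℕ) : ℝ)) ^ (k + 1)) ^ 2 + 7 * α ^ 2) * ((((2 : ℕ) : ℝ)) ^ (k + 1)) ^ 2)) :
    ∃ γ : ℝ, 0 < γ ∧ ∀ V : Site 4 → Fin 4 → (Matrix n n ℂ)ˣ, IsUnitaryCfg V → IsPeriodicCfg V (N : ℤ) → SmallField V γ →
      ∀ (k : ℕ) (U₀ : Site 4 → Fin 4 → (Matrix n n ℂ)ˣ), U₀ ∈ admissible (sfClass 4 2 N ε) 2 (k + 1) V →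
        SmallField U₀ (δ / ((((2 : ℕ) : ℝ)) ^ k) ^ 2) →
        ∃ U, IsMinimiser 4 (sfClass 4 2 N ε) 2 N (k + 1) V U ∧ SmallField U (δ / ((((2 : ℕ) : ℝ)) ^ (k + 1)) ^ 2) := by
  have hCP : 0 < 8 * CPLine 4 2 2 (1 / 10 ^ 17) (1 / 10 ^ 53) + 1 := by linarith [CPLine_nonneg_d4_L2]
  have hls := levelSmall_all_d4_L2 hε.le (hε'.trans (by norm_num))
  obtain ⟨hε1, hε2⟩ := classSmall_d4_L2 hε'
  exact oneStep_of_dataClass_ape_rep_generic_gauge (by norm_num) hN hε.le hε1 hε2 hδ₁ hδ₁δ hδε hCP hβ hls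
    (fun j W => energyBlockLandauW (d := 4) (n := n) 2 N (j + 1) W)
    (fun j W hW F htan => hT_energyBlockLandau (by norm_num) hε.le hls j W hW F htan)
    (fun j W hW => slicePoincare_mono (classSlicePoincare_energyBlockLandau_SU2 hn hN hε hε' j W hW) (by linarith)) hape hrep

end

end Summit.QuantumFields.BalabanUV.T4Continuum.NE7SoftDataPathGenericSlice
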